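import Summits.NavierStokesRegularity.NavierStokesRegularity.Theorems.WakeRatchetEternalViscousRateCircuitPumpKill
import Summits.NavierStokesRegularity.NavierStokesRegularity.Theorems.WakeRatchetEternalViscousRateCircuitPumpPad
import Summits.NavierStokesRegularity.NavierStokesRegularity.Theorems.WakeRatchetEternalViscousRateCircuitPumpPadClass
import Summits.NavierStokesRegularity.NavierStokesRegularity.Theorems.WakeRatchetEternalViscousRateCircuitPumpTodaClass

/-!
# `WakeRatchet.EternalViscousRate` (stmt-NavierStokesRegularity-25647): NO SPREAD-UNIFORM THRESHOLD, modulo the re-export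
# of the tree's seeded-Toda perpetual pump with its table (headline of the `…CircuitPump*` chain of this session)

`EternalViscousRate` reads `∀ R ≥ 1, ∃ a > 1, ∃ εs > 0, ∀ ε₀ ≤ εs, ∀ α ∈ E₂(R), …`.  Its SPREAD-UNIFORM strengthening
`∃ a > 1, ∃ εs > 0, ∀ R ≥ 1, ∀ ε₀ ≤ εs, ∀ α ∈ E₂(R), …` is FALSE as soon as the seeded graded Toda pump of
`PerpetualPump.CircuitPump` is available WITH ITS TABLE at every fine scale ratio — hypothesis `(H)` below: for every
`lam₀ > 1` some `lam ∈ (1, lam₀)`, seed `ε ∈ (0, 10⁻⁵]` and a solution `X : Fin 2 → ℤ → ℝ → ℝ` of the m = 2 seeded graded Toda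
circuit (`SolvesODE lam (T^{opt}_ε) X`) that is exactly self-similar (`IsDSS lam 1 X`), Type I, non-trivial, with shells
bounded near the blow-up time.  `(H)` is exactly what the PROOF of `PerpetualPumpCircuitPump.stub_clockBox` +
`CircuitPump_proof` constructs (the crux STATEMENT `CircuitPump` hides `m` and the table behind `∃`; its last clause is
`CircuitPumpNegative.typeI_critical_bound`); re-exporting it is blocked today only by the farm's build state of those
modules (`…CircuitPumpBdd`, p827110, discharges the boundedness clause the same way).  The proof: pad the witness to `Fin 4`
(`…CircuitPumpPad`), identify its pulled-back table with the padding of the m = 2 Toda member of `E₂(2/ε)`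
(`…CircuitPumpTodaClass`, `…CircuitPumpPadClass`; the tree's explicit `T_ε` of `WakeRatchetSeededToda.inTableClass_seededToda`,
p817230, is the same table), renormalise and kill the contraction at `ε₀ = lam^{2/5} - 1 ≤ εs` for the given `a`
(`…CircuitPumpKill`, via `WakeRatchetViscDSS.not_rateContraction_of_viscBlockDSS`) on the table of spread `R = 2/ε`.
So ⟨25647⟩ can hold only with `εs = εs(R) → 0` as `R → ∞` — the kernel form of the rotor-circuit numerics recorded on ⟨25646⟩.
HONEST LABEL: MODEL lattice ODEs only (Tao 2016 §4, §6.4); conditional on (H); ⟨25647⟩ itself (εs depending on R) is neither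
proved nor refuted; nothing here bears on the Navier–Stokes equations.
-/

set_option linter.dupNamespace false

noncomputable section

open scoped BigOperators
open Real Set Filter Topology MeasureTheory

namespace Summit.NavierStokesRegularity.NavierStokesRegularity.Theorems.WakeRatchetCircuitPumpNoUniform

open Summit.NavierStokesRegularity.NavierStokesRegularity.Theorems.CircuitPumpNegative
open Summit.NavierStokesRegularity.NavierStokesRegularity.Theorems.WakeRatchetCircuitPumpTable
open Summit.NavierStokesRegularity.NavierStokesRegularity.Theorems.WakeRatchetCircuitPumpAssembly
open Summit.NavierStokesRegularity.NavierStokesRegularity.Theorems.WakeRatchetCircuitPumpAction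
open Summit.NavierStokesRegularity.NavierStokesRegularity.Theorems.WakeRatchetCircuitPumpKill
open Summit.NavierStokesRegularity.NavierStokesRegularity.Theorems.WakeRatchetCircuitPumpPad
open Summit.NavierStokesRegularity.NavierStokesRegularity.Theorems.WakeRatchetCircuitPumpPadClass
open Summit.NavierStokesRegularity.NavierStokesRegularity.Theorems.WakeRatchetCircuitPumpTodaClass
open Summit.NavierStokesRegularity.NavierStokesRegularity.Theorems.WakeRatchetViscDSS
open Literature.Analysis.FluidPDE Literature.Analysis.FluidPDE.TaoCascade

variable {m : ℕ}

/-- Variant of `WakeRatchetCircuitPumpKill.not_rateContraction_of_pumpWitness` taking Tao's cancellation (4.3) of the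
PULLED-BACK table as hypothesis (instead of the pump encoding's `IsCyc`), so that padded tables can be fed through
`WakeRatchetCircuitPumpPadClass.inTableClass_pad`.
[cite: Tao2016AveragedNS, §4 Thm. 4.2 (statement shape), the viscous equation before it, §6.4; cell vocabulary (stmt-NavierStokesRegularity-25647)] -/
theorem not_rateContraction_of_pumpWitness₂ {lam : ℝ} (hlam : 1 < lam)
    (coeff : Fin m → Fin m → Fin m → Option (Fin 3) → ℝ)
    (hc : IsCancellingCoeff (fun (i₁ i₂ i₃ : Fin m) (μ : ℤ × ℤ × ℤ) =>
        if μ = (0, 0, 0) then coeff i₁ i₂ i₃ none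
        else if μ = (1, 0, 0) then coeff i₁ i₂ i₃ (some 0)
        else if μ = (0, 1, 0) then coeff i₁ i₂ i₃ (some 1)
        else if μ = (0, 0, 1) then coeff i₁ i₂ i₃ (some 2) else 0))
    (X : Fin m → ℤ → ℝ → ℝ)
    (hode : SolvesODE lam coeff X) (hdss : IsDSS lam 1 X) (hTI : IsTypeI lam X) (hnt : IsNontrivial X)
    (hbd : ∀ n : ℤ, ∃ P : ℝ, ∀ t : ℝ, -(1 / 2) ≤ t → t < 0 → ‖shellVec X n t‖ ≤ P) {a : ℝ} (ha : 1 < a) :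
    ∃ (ε₀ : ℝ) (W : ℤ → ℝ → Em m), 0 < ε₀ ∧ (1 + ε₀) ^ ((5 : ℝ) / 2) = lam ∧
      IsEternalVisc ε₀ 1 (fun (i₁ i₂ i₃ : Fin m) (μ : ℤ × ℤ × ℤ) =>
        if μ = (0, 0, 0) then coeff i₁ i₂ i₃ none
        else if μ = (1, 0, 0) then coeff i₁ i₂ i₃ (some 0)
        else if μ = (0, 1, 0) then coeff i₁ i₂ i₃ (some 1)
        else if μ = (0, 0, 1) then coeff i₁ i₂ i₃ (some 2) else 0) W ∧
      UniformBound W ∧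
      ¬ ∀ (n : ℤ) (M : ℝ), (∀ σ : ℝ, ∑' k : ℕ, physEnergy ε₀ W (n + k) σ ≤ M) →
          ∀ σ : ℝ, ∑' k : ℕ, physEnergy ε₀ W (n + 1 + k) σ ≤ (1 + ε₀) ^ (-a) * M := by
  obtain ⟨M, hact⟩ := action_of_typeI hlam coeff X hode hTI
  obtain ⟨ε₀, W, hε, hlamε, hW, hU, hD, hne⟩ :=
    viscousBlockDSS_of_pumpWitness hlam coeff X hode hdss hTI hnt hact hbd
  refine ⟨ε₀, W, hε, hlamε, hW, hU, ?_⟩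
  obtain ⟨n₀, σ₀, hne₀⟩ := hne
  have hD' : ∀ (n : ℤ) (σ : ℝ), W (n + (1 : ℕ)) σ = W n (σ - 2 * Real.log (1 + ε₀)) := by
    intro n σ
    simpa using hD n σ
  exact not_rateContraction_of_viscBlockDSS hε one_pos ha hc hW hU one_pos hD' hne₀

/-- Zero-padding does not change the norm of a shell vector. [elementary] -/
theorem norm_shellVec_pad {k : ℕ} (X : Fin m → ℤ → ℝ → ℝ) (n : ℤ) (t : ℝ) :
    ‖shellVec (Fin.append X (fun (_ : Fin k) (_ : ℤ) (_ : ℝ) => (0 : ℝ))) n t‖ = ‖shellVec X n t‖ := by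
  rw [EuclideanSpace.norm_eq, EuclideanSpace.norm_eq, Fin.sum_univ_add]
  simp [shellVec_apply, Fin.append_left, Fin.append_right]


/-- The pulled-back seeded Toda table (pump encoding `T^{opt}_ε` through the dictionary of `…CircuitPumpTable`) IS the
explicit m = 2 table of `…CircuitPumpTodaClass.todaTable_inTableClass`. [elementary] -/
theorem toda_pullback_eq (ε : ℝ) :
    (fun (i₁ i₂ i₃ : Fin 2) (μ : ℤ × ℤ × ℤ) =>
        if μ = (0, 0, 0) then (fun (i₁ i₂ i₃ : Fin 2) (μ : Option (Fin 3)) => if μ = none then (if i₁ = 1 ∧ i₂ = 1 ∧ i₃ = 0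
          then (-1 : ℝ) else if i₁ = 1 ∧ i₂ = 0 ∧ i₃ = 1 then 1 / 2 else if i₁ = 0 ∧ i₂ = 1 ∧ i₃ = 1
          then 1 / 2 else if i₁ = 0 ∧ i₂ = 0 ∧ i₃ = 1 then ε else if i₁ = 0 ∧ i₂ = 1 ∧ i₃ = 0 then -ε /
          2 else if i₁ = 1 ∧ i₂ = 0 ∧ i₃ = 0 then -ε / 2 else 0) else if μ = some 2 then (if i₁ = 1 ∧
          i₂ = 1 ∧ i₃ = 0 then 1 else 0) else if μ = some 1 then (if i₁ = 1 ∧ i₂ = 0 ∧ i₃ = 1 then -1 /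
          2 else 0) else (if i₁ = 0 ∧ i₂ = 1 ∧ i₃ = 1 then -1 / 2 else 0)) i₁ i₂ i₃ none
        else if μ = (1, 0, 0) then (fun (i₁ i₂ i₃ : Fin 2) (μ : Option (Fin 3)) => if μ = none then (if i₁ = 1 ∧ i₂ = 1 ∧ i₃ = 0
          then (-1 : ℝ) else if i₁ = 1 ∧ i₂ = 0 ∧ i₃ = 1 then 1 / 2 else if i₁ = 0 ∧ i₂ = 1 ∧ i₃ = 1
          then 1 / 2 else if i₁ = 0 ∧ i₂ = 0 ∧ i₃ = 1 then ε else if i₁ = 0 ∧ i₂ = 1 ∧ i₃ = 0 then -ε /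
          2 else if i₁ = 1 ∧ i₂ = 0 ∧ i₃ = 0 then -ε / 2 else 0) else if μ = some 2 then (if i₁ = 1 ∧
          i₂ = 1 ∧ i₃ = 0 then 1 else 0) else if μ = some 1 then (if i₁ = 1 ∧ i₂ = 0 ∧ i₃ = 1 then -1 /
          2 else 0) else (if i₁ = 0 ∧ i₂ = 1 ∧ i₃ = 1 then -1 / 2 else 0)) i₁ i₂ i₃ (some 0)
        else if μ = (0, 1, 0) then (fun (i₁ i₂ i₃ : Fin 2) (μ : Option (Fin 3)) => if μ = none then (if i₁ = 1 ∧ i₂ = 1 ∧ i₃ = 0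
          then (-1 : ℝ) else if i₁ = 1 ∧ i₂ = 0 ∧ i₃ = 1 then 1 / 2 else if i₁ = 0 ∧ i₂ = 1 ∧ i₃ = 1
          then 1 / 2 else if i₁ = 0 ∧ i₂ = 0 ∧ i₃ = 1 then ε else if i₁ = 0 ∧ i₂ = 1 ∧ i₃ = 0 then -ε /
          2 else if i₁ = 1 ∧ i₂ = 0 ∧ i₃ = 0 then -ε / 2 else 0) else if μ = some 2 then (if i₁ = 1 ∧
          i₂ = 1 ∧ i₃ = 0 then 1 else 0) else if μ = some 1 then (if i₁ = 1 ∧ i₂ = 0 ∧ i₃ = 1 then -1 /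
          2 else 0) else (if i₁ = 0 ∧ i₂ = 1 ∧ i₃ = 1 then -1 / 2 else 0)) i₁ i₂ i₃ (some 1)
        else if μ = (0, 0, 1) then (fun (i₁ i₂ i₃ : Fin 2) (μ : Option (Fin 3)) => if μ = none then (if i₁ = 1 ∧ i₂ = 1 ∧ i₃ = 0
          then (-1 : ℝ) else if i₁ = 1 ∧ i₂ = 0 ∧ i₃ = 1 then 1 / 2 else if i₁ = 0 ∧ i₂ = 1 ∧ i₃ = 1
          then 1 / 2 else if i₁ = 0 ∧ i₂ = 0 ∧ i₃ = 1 then ε else if i₁ = 0 ∧ i₂ = 1 ∧ i₃ = 0 then -ε /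
          2 else if i₁ = 1 ∧ i₂ = 0 ∧ i₃ = 0 then -ε / 2 else 0) else if μ = some 2 then (if i₁ = 1 ∧
          i₂ = 1 ∧ i₃ = 0 then 1 else 0) else if μ = some 1 then (if i₁ = 1 ∧ i₂ = 0 ∧ i₃ = 1 then -1 /
          2 else 0) else (if i₁ = 0 ∧ i₂ = 1 ∧ i₃ = 1 then -1 / 2 else 0)) i₁ i₂ i₃ (some 2) else 0) =
    (fun (i₁ i₂ i₃ : Fin 2) (μ : ℤ × ℤ × ℤ) =>
      if μ = (0, 0, 0) then
        (if i₁ = 1 ∧ i₂ = 1 ∧ i₃ = 0 then (-1 : ℝ) else if i₁ = 1 ∧ i₂ = 0 ∧ i₃ = 1 then 1 / 2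
          else if i₁ = 0 ∧ i₂ = 1 ∧ i₃ = 1 then 1 / 2 else if i₁ = 0 ∧ i₂ = 0 ∧ i₃ = 1 then ε
          else if i₁ = 0 ∧ i₂ = 1 ∧ i₃ = 0 then -ε / 2 else if i₁ = 1 ∧ i₂ = 0 ∧ i₃ = 0 then -ε / 2 else 0)
      else if μ = (1, 0, 0) then (if i₁ = 0 ∧ i₂ = 1 ∧ i₃ = 1 then -1 / 2 else 0)
      else if μ = (0, 1, 0) then (if i₁ = 1 ∧ i₂ = 0 ∧ i₃ = 1 then -1 / 2 else 0)
      else if μ = (0, 0, 1) then (if i₁ = 1 ∧ i₂ = 1 ∧ i₃ = 0 then 1 else 0) else 0) := by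
  funext i₁ i₂ i₃ μ
  fin_cases i₁ <;> fin_cases i₂ <;> fin_cases i₃ <;> simp

/-- **No spread-uniform threshold for `EternalViscousRate`, modulo the re-export `(H)` of the tree's seeded-Toda pump.**
See the module docstring.
[cite: Tao2016AveragedNS, §4 Thm. 4.2 (statement shape), the viscous equation before it, §6.4; cell vocabulary (stmt-NavierStokesRegularity-25647)] -/
theorem no_uniform_threshold_of_todaPump
    (H : ∀ lam₀ : ℝ, 1 < lam₀ → ∃ lam : ℝ, 1 < lam ∧ lam < lam₀ ∧ ∃ ε : ℝ, 0 < ε ∧ ε ≤ 1 / 100000 ∧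
      ∃ X : Fin 2 → ℤ → ℝ → ℝ,
        SolvesODE lam (fun (i₁ i₂ i₃ : Fin 2) (μ : Option (Fin 3)) => if μ = none then (if i₁ = 1 ∧ i₂ = 1 ∧ i₃ = 0
          then (-1 : ℝ) else if i₁ = 1 ∧ i₂ = 0 ∧ i₃ = 1 then 1 / 2 else if i₁ = 0 ∧ i₂ = 1 ∧ i₃ = 1
          then 1 / 2 else if i₁ = 0 ∧ i₂ = 0 ∧ i₃ = 1 then ε else if i₁ = 0 ∧ i₂ = 1 ∧ i₃ = 0 then -ε /
          2 else if i₁ = 1 ∧ i₂ = 0 ∧ i₃ = 0 then -ε / 2 else 0) else if μ = some 2 then (if i₁ = 1 ∧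
          i₂ = 1 ∧ i₃ = 0 then 1 else 0) else if μ = some 1 then (if i₁ = 1 ∧ i₂ = 0 ∧ i₃ = 1 then -1 /
          2 else 0) else (if i₁ = 0 ∧ i₂ = 1 ∧ i₃ = 1 then -1 / 2 else 0)) X ∧
        IsDSS lam 1 X ∧ IsTypeI lam X ∧ IsNontrivial X ∧
        ∀ n : ℤ, ∃ P : ℝ, ∀ t : ℝ, -(1 / 2) ≤ t → t < 0 → ‖shellVec X n t‖ ≤ P) :
    ¬ ∃ a : ℝ, 1 < a ∧ ∃ εs : ℝ, 0 < εs ∧ ∀ R : ℝ, 1 ≤ R → ∀ ε₀ : ℝ, 0 < ε₀ → ε₀ ≤ εs →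
        ∀ α : Fin 4 → Fin 4 → Fin 4 → ℤ × ℤ × ℤ → ℝ, InTableClass R α →
        ∀ (νh : ℝ) (W : ℤ → ℝ → Em 4), 0 < νh → IsEternalVisc ε₀ νh α W → UniformBound W →
        ∀ (n : ℤ) (M : ℝ), (∀ σ : ℝ, ∑' k : ℕ, physEnergy ε₀ W (n + k) σ ≤ M) →
          ∀ σ : ℝ, ∑' k : ℕ, physEnergy ε₀ W (n + 1 + k) σ ≤ (1 + ε₀) ^ (-a) * M := by
  rintro ⟨a, ha, εs, hεs, hU⟩
  -- the scale window
  have hb : (1 : ℝ) < (1 + εs) ^ ((5 : ℝ) / 2) := Real.one_lt_rpow (by linarith) (by norm_num)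
  have hlam₀ : 1 < min (3 / 2 : ℝ) ((1 + εs) ^ ((5 : ℝ) / 2)) := lt_min (by norm_num) hb
  obtain ⟨lam, hlam, hlt, ε, hε, hε5, X, hode, hdss, hTI, hnt, hbd⟩ := H _ hlam₀
  have hlt' : lam < (1 + εs) ^ ((5 : ℝ) / 2) := lt_of_lt_of_le hlt (min_le_right _ _)
  -- pad to four modes
  have hode₄ := solvesODE_pad (k := 2) hode
  have hdss₄ := isDSS_pad (k := 2) hdss
  have hTI₄ := isTypeI_pad (k := 2) hlam hTI
  have hnt₄ := isNontrivial_pad (k := 2) hnt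
  have hbd₄ : ∀ n : ℤ, ∃ P : ℝ, ∀ t : ℝ, -(1 / 2) ≤ t → t < 0 →
      ‖shellVec (Fin.append X (fun (_ : Fin 2) (_ : ℤ) (_ : ℝ) => (0 : ℝ))) n t‖ ≤ P := by
    intro n
    obtain ⟨P, hP⟩ := hbd n
    exact ⟨P, fun t h1 h2 => by rw [norm_shellVec_pad]; exact hP t h1 h2⟩
  -- the padded pulled-back table is the padding of the m = 2 Toda member of `E₂(2/ε)`
  have hε1 : ε ≤ 1 := by linarith
  have h2 : InTableClass (2 / ε) (fun (i₁ i₂ i₃ : Fin 2) (μ : ℤ × ℤ × ℤ) =>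
            if μ = (0, 0, 0) then (fun (i₁ i₂ i₃ : Fin 2) (μ : Option (Fin 3)) => if μ = none then (if i₁ = 1 ∧ i₂ = 1 ∧ i₃ = 0
              then (-1 : ℝ) else if i₁ = 1 ∧ i₂ = 0 ∧ i₃ = 1 then 1 / 2 else if i₁ = 0 ∧ i₂ = 1 ∧ i₃ = 1
              then 1 / 2 else if i₁ = 0 ∧ i₂ = 0 ∧ i₃ = 1 then ε else if i₁ = 0 ∧ i₂ = 1 ∧ i₃ = 0 then -ε /
              2 else if i₁ = 1 ∧ i₂ = 0 ∧ i₃ = 0 then -ε / 2 else 0) else if μ = some 2 then (if i₁ = 1 ∧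
              i₂ = 1 ∧ i₃ = 0 then 1 else 0) else if μ = some 1 then (if i₁ = 1 ∧ i₂ = 0 ∧ i₃ = 1 then -1 /
              2 else 0) else (if i₁ = 0 ∧ i₂ = 1 ∧ i₃ = 1 then -1 / 2 else 0)) i₁ i₂ i₃ none
            else if μ = (1, 0, 0) then (fun (i₁ i₂ i₃ : Fin 2) (μ : Option (Fin 3)) => if μ = none then (if i₁ = 1 ∧ i₂ = 1 ∧ i₃ = 0
              then (-1 : ℝ) else if i₁ = 1 ∧ i₂ = 0 ∧ i₃ = 1 then 1 / 2 else if i₁ = 0 ∧ i₂ = 1 ∧ i₃ = 1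
              then 1 / 2 else if i₁ = 0 ∧ i₂ = 0 ∧ i₃ = 1 then ε else if i₁ = 0 ∧ i₂ = 1 ∧ i₃ = 0 then -ε /
              2 else if i₁ = 1 ∧ i₂ = 0 ∧ i₃ = 0 then -ε / 2 else 0) else if μ = some 2 then (if i₁ = 1 ∧
              i₂ = 1 ∧ i₃ = 0 then 1 else 0) else if μ = some 1 then (if i₁ = 1 ∧ i₂ = 0 ∧ i₃ = 1 then -1 /
              2 else 0) else (if i₁ = 0 ∧ i₂ = 1 ∧ i₃ = 1 then -1 / 2 else 0)) i₁ i₂ i₃ (some 0)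
            else if μ = (0, 1, 0) then (fun (i₁ i₂ i₃ : Fin 2) (μ : Option (Fin 3)) => if μ = none then (if i₁ = 1 ∧ i₂ = 1 ∧ i₃ = 0
              then (-1 : ℝ) else if i₁ = 1 ∧ i₂ = 0 ∧ i₃ = 1 then 1 / 2 else if i₁ = 0 ∧ i₂ = 1 ∧ i₃ = 1
              then 1 / 2 else if i₁ = 0 ∧ i₂ = 0 ∧ i₃ = 1 then ε else if i₁ = 0 ∧ i₂ = 1 ∧ i₃ = 0 then -ε /
              2 else if i₁ = 1 ∧ i₂ = 0 ∧ i₃ = 0 then -ε / 2 else 0) else if μ = some 2 then (if i₁ = 1 ∧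
              i₂ = 1 ∧ i₃ = 0 then 1 else 0) else if μ = some 1 then (if i₁ = 1 ∧ i₂ = 0 ∧ i₃ = 1 then -1 /
              2 else 0) else (if i₁ = 0 ∧ i₂ = 1 ∧ i₃ = 1 then -1 / 2 else 0)) i₁ i₂ i₃ (some 1)
            else if μ = (0, 0, 1) then (fun (i₁ i₂ i₃ : Fin 2) (μ : Option (Fin 3)) => if μ = none then (if i₁ = 1 ∧ i₂ = 1 ∧ i₃ = 0
              then (-1 : ℝ) else if i₁ = 1 ∧ i₂ = 0 ∧ i₃ = 1 then 1 / 2 else if i₁ = 0 ∧ i₂ = 1 ∧ i₃ = 1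
              then 1 / 2 else if i₁ = 0 ∧ i₂ = 0 ∧ i₃ = 1 then ε else if i₁ = 0 ∧ i₂ = 1 ∧ i₃ = 0 then -ε /
              2 else if i₁ = 1 ∧ i₂ = 0 ∧ i₃ = 0 then -ε / 2 else 0) else if μ = some 2 then (if i₁ = 1 ∧
              i₂ = 1 ∧ i₃ = 0 then 1 else 0) else if μ = some 1 then (if i₁ = 1 ∧ i₂ = 0 ∧ i₃ = 1 then -1 /
              2 else 0) else (if i₁ = 0 ∧ i₂ = 1 ∧ i₃ = 1 then -1 / 2 else 0)) i₁ i₂ i₃ (some 2) else 0) := by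
    rw [toda_pullback_eq ε]
    exact todaTable_inTableClass ε hε hε1
  have hclass : InTableClass (2 / ε) (fun (j₁ j₂ j₃ : Fin (2 + 2)) (μ : ℤ × ℤ × ℤ) =>
            if μ = (0, 0, 0) then (Fin.append (fun i₁ : Fin 2 => Fin.append (fun i₂ : Fin 2 => Fin.append ((fun (i₁ i₂ i₃ : Fin 2) (μ : Option (Fin 3)) => if μ = none then (if i₁ = 1 ∧ i₂ = 1 ∧ i₃ = 0
              then (-1 : ℝ) else if i₁ = 1 ∧ i₂ = 0 ∧ i₃ = 1 then 1 / 2 else if i₁ = 0 ∧ i₂ = 1 ∧ i₃ = 1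
              then 1 / 2 else if i₁ = 0 ∧ i₂ = 0 ∧ i₃ = 1 then ε else if i₁ = 0 ∧ i₂ = 1 ∧ i₃ = 0 then -ε /
              2 else if i₁ = 1 ∧ i₂ = 0 ∧ i₃ = 0 then -ε / 2 else 0) else if μ = some 2 then (if i₁ = 1 ∧
              i₂ = 1 ∧ i₃ = 0 then 1 else 0) else if μ = some 1 then (if i₁ = 1 ∧ i₂ = 0 ∧ i₃ = 1 then -1 /
              2 else 0) else (if i₁ = 0 ∧ i₂ = 1 ∧ i₃ = 1 then -1 / 2 else 0)) i₁ i₂)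
              (fun (_ : Fin 2) (_ : Option (Fin 3)) => (0 : ℝ)))
            (fun (_ : Fin 2) (_ : Fin (2 + 2)) (_ : Option (Fin 3)) => (0 : ℝ)))
            (fun (_ : Fin 2) (_ : Fin (2 + 2)) (_ : Fin (2 + 2)) (_ : Option (Fin 3)) => (0 : ℝ))) j₁ j₂ j₃ none
            else if μ = (1, 0, 0) then (Fin.append (fun i₁ : Fin 2 => Fin.append (fun i₂ : Fin 2 => Fin.append ((fun (i₁ i₂ i₃ : Fin 2) (μ : Option (Fin 3)) => if μ = none then (if i₁ = 1 ∧ i₂ = 1 ∧ i₃ = 0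
              then (-1 : ℝ) else if i₁ = 1 ∧ i₂ = 0 ∧ i₃ = 1 then 1 / 2 else if i₁ = 0 ∧ i₂ = 1 ∧ i₃ = 1
              then 1 / 2 else if i₁ = 0 ∧ i₂ = 0 ∧ i₃ = 1 then ε else if i₁ = 0 ∧ i₂ = 1 ∧ i₃ = 0 then -ε /
              2 else if i₁ = 1 ∧ i₂ = 0 ∧ i₃ = 0 then -ε / 2 else 0) else if μ = some 2 then (if i₁ = 1 ∧
              i₂ = 1 ∧ i₃ = 0 then 1 else 0) else if μ = some 1 then (if i₁ = 1 ∧ i₂ = 0 ∧ i₃ = 1 then -1 /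
              2 else 0) else (if i₁ = 0 ∧ i₂ = 1 ∧ i₃ = 1 then -1 / 2 else 0)) i₁ i₂)
              (fun (_ : Fin 2) (_ : Option (Fin 3)) => (0 : ℝ)))
            (fun (_ : Fin 2) (_ : Fin (2 + 2)) (_ : Option (Fin 3)) => (0 : ℝ)))
            (fun (_ : Fin 2) (_ : Fin (2 + 2)) (_ : Fin (2 + 2)) (_ : Option (Fin 3)) => (0 : ℝ))) j₁ j₂ j₃ (some 0)
            else if μ = (0, 1, 0) then (Fin.append (fun i₁ : Fin 2 => Fin.append (fun i₂ : Fin 2 => Fin.append ((fun (i₁ i₂ i₃ : Fin 2) (μ : Option (Fin 3)) => if μ = none then (if i₁ = 1 ∧ i₂ = 1 ∧ i₃ = 0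
              then (-1 : ℝ) else if i₁ = 1 ∧ i₂ = 0 ∧ i₃ = 1 then 1 / 2 else if i₁ = 0 ∧ i₂ = 1 ∧ i₃ = 1
              then 1 / 2 else if i₁ = 0 ∧ i₂ = 0 ∧ i₃ = 1 then ε else if i₁ = 0 ∧ i₂ = 1 ∧ i₃ = 0 then -ε /
              2 else if i₁ = 1 ∧ i₂ = 0 ∧ i₃ = 0 then -ε / 2 else 0) else if μ = some 2 then (if i₁ = 1 ∧
              i₂ = 1 ∧ i₃ = 0 then 1 else 0) else if μ = some 1 then (if i₁ = 1 ∧ i₂ = 0 ∧ i₃ = 1 then -1 /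
              2 else 0) else (if i₁ = 0 ∧ i₂ = 1 ∧ i₃ = 1 then -1 / 2 else 0)) i₁ i₂)
              (fun (_ : Fin 2) (_ : Option (Fin 3)) => (0 : ℝ)))
            (fun (_ : Fin 2) (_ : Fin (2 + 2)) (_ : Option (Fin 3)) => (0 : ℝ)))
            (fun (_ : Fin 2) (_ : Fin (2 + 2)) (_ : Fin (2 + 2)) (_ : Option (Fin 3)) => (0 : ℝ))) j₁ j₂ j₃ (some 1)
            else if μ = (0, 0, 1) then (Fin.append (fun i₁ : Fin 2 => Fin.append (fun i₂ : Fin 2 => Fin.append ((fun (i₁ i₂ i₃ : Fin 2) (μ : Option (Fin 3)) => if μ = none then (if i₁ = 1 ∧ i₂ = 1 ∧ i₃ = 0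
              then (-1 : ℝ) else if i₁ = 1 ∧ i₂ = 0 ∧ i₃ = 1 then 1 / 2 else if i₁ = 0 ∧ i₂ = 1 ∧ i₃ = 1
              then 1 / 2 else if i₁ = 0 ∧ i₂ = 0 ∧ i₃ = 1 then ε else if i₁ = 0 ∧ i₂ = 1 ∧ i₃ = 0 then -ε /
              2 else if i₁ = 1 ∧ i₂ = 0 ∧ i₃ = 0 then -ε / 2 else 0) else if μ = some 2 then (if i₁ = 1 ∧
              i₂ = 1 ∧ i₃ = 0 then 1 else 0) else if μ = some 1 then (if i₁ = 1 ∧ i₂ = 0 ∧ i₃ = 1 then -1 /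
              2 else 0) else (if i₁ = 0 ∧ i₂ = 1 ∧ i₃ = 1 then -1 / 2 else 0)) i₁ i₂)
              (fun (_ : Fin 2) (_ : Option (Fin 3)) => (0 : ℝ)))
            (fun (_ : Fin 2) (_ : Fin (2 + 2)) (_ : Option (Fin 3)) => (0 : ℝ)))
            (fun (_ : Fin 2) (_ : Fin (2 + 2)) (_ : Fin (2 + 2)) (_ : Option (Fin 3)) => (0 : ℝ))) j₁ j₂ j₃ (some 2) else 0) := by
    rw [pullback_pad_comm]
    exact inTableClass_pad (k := 2) h2
  -- kill at `ε₀ = lam^{2/5} - 1`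
  obtain ⟨ε₀, W, hε₀, hlamε, hW, hUB, hnot⟩ :=
    not_rateContraction_of_pumpWitness₂ hlam _ hclass.2.1 _ hode₄ hdss₄ hTI₄ hnt₄ hbd₄ ha
  -- `ε₀ ≤ εs` and `R = 2/ε ≥ 1`
  have hε₀le : ε₀ ≤ εs := by
    by_contra hcon
    have h1 : (1 + εs) ^ ((5 : ℝ) / 2) ≤ (1 + ε₀) ^ ((5 : ℝ) / 2) :=
      Real.rpow_le_rpow (by linarith) (by linarith) (by norm_num)
    rw [hlamε] at h1
    linarith
  have hR : (1 : ℝ) ≤ 2 / ε := by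
    rw [le_div_iff₀ hε]; linarith
  exact hnot (hU (2 / ε) hR ε₀ hε₀ hε₀le _ hclass 1 W one_pos hW hUB)

end Summit.NavierStokesRegularity.NavierStokesRegularity.Theorems.WakeRatchetCircuitPumpNoUniform

end
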